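import Literature.Analysis.FluidPDE.Seregin2019TopSlicePairing
import Literature.Analysis.FluidPDE.BlowupTopVanishing
import HarnessLib

/-!
# Seregin 2019, §4: the pairings of the rescaled velocities near the top time are small,
# uniformly along the sequence

Analysis/FluidPDE proofs-only file (theorems only: no definitions, no named facts, no `sorry`),
a tranche of the input `Literature.Analysis.FluidPDE.seregin2019_localWeakL3_epsRegularity`
(`Seregin2019LocalWeakL3.lean`; G. Seregin, arXiv:1906.06707 = St. Petersburg Math. J. 32 (2021)
565–576, §4). No Navier–Stokes regularity statement is proved here.

For one rescaled pair `(U, P)` of the contradiction sequence of §4 — a suitable weak solution in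
a large parabolic ball `Q(0, L)` whose slices are weak-`L³` (`t³|{y ∈ B(0,L) : t < |U(s,y)|}| ≤ M³`),
whose top slice `U(0)` is the weak left limit of the slices and is sparse
(`|{y ∈ B(0,ϱ) : τ < |U(0,y)|}| ≤ m`), and whose gauged pressure has `D(ρ₀; 0) ≤ K` — this file
bounds the pairings `s ↦ ∫⟪U(s), φ⟫` with a fixed test field near `s = 0`:

* `Seregin2019.exists_uniform_pairing_modulus` — the weak equicontinuity in time of
  Navier–Stokes velocities (the tree's `NSCylinder.exists_fullMeasure_pairing_modulus`, Temam
  Ch. III §3): constants `A, B`, depending on `φ, ρ₀, M, K` only, with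
  `|∫⟪U(s),φ⟫ − ∫⟪U(s'),φ⟫| ≤ A|s−s'| + B|s−s'|^{1/3}` on a full-measure set of `]-ρ₀²,0[`, for EVERY
  such pair (this uniformity along the sequence is what the compactness passage needs);
* `Seregin2019.abs_top_pairing_le` — combined with the weak left-continuity at the top time and
  the sparse-slice bound `Seregin2019.abs_integral_inner_top_le`: on that full-measure set,
  `|∫⟪U(s),φ⟫| ≤ Θ₀ (m λ + ½ λ⁻² M³) + τ ∫|φ| + A|s| + B|s|^{1/3}`.

In print this is the content of (4.9) and of "`u(x,0) = 0` … follows from the known inequality"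
(p. 8), where the time regularity comes from the estimate (4.10) of `∂ₜu^k`.

## References

* G. Seregin, arXiv:1906.06707 (2019), §4, (4.9)–(4.10) and p. 8. [`Seregin2019`]
* R. Temam, *Navier–Stokes equations* (1977/79), Ch. III §3 (3.40)–(3.43). [Temam1979]
-/

noncomputable section

open MeasureTheory Set Function Filter Topology TopologicalSpace Metric
open scoped NNReal ENNReal InnerProductSpace RealInnerProductSpace

namespace Literature.Analysis.FluidPDE

namespace Seregin2019

open Literature.Analysis.FunctionSpaces

/-- The slices of a suitable weak solution in `Q(0,L)` are a.e.-strongly measurable on `B(0,L)`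
for a.e. `s ∈ ]-L²,0[` — part of the class `v ∈ L_{2,∞}(Q_T)` of Seregin's Definition 1.1
(suitable weak solutions after F.-H. Lin), here read off by Fubini from the measurability of `u`
on the cylinder. [cite: Seregin2019, §1 Definition 1.1 (v ∈ L_{2,∞}(Q_T))] -/
theorem ae_aestronglyMeasurable_slice_of_inBall {L : ℝ}
    {U : ℝ → EuclideanSpace ℝ (Fin 3) → EuclideanSpace ℝ (Fin 3)} {P : ℝ → EuclideanSpace ℝ (Fin 3) → ℝ}
    (hU : IsSuitableWeakSolutionInBall L (0 : ℝ × EuclideanSpace ℝ (Fin 3)) U P) :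
    ∀ᵐ s ∂(volume.restrict (Ioo (-L ^ 2) (0 : ℝ))),
      AEStronglyMeasurable (U s) (volume.restrict (ball (0 : EuclideanSpace ℝ (Fin 3)) L)) := by
  have hm : AEStronglyMeasurable (uncurry U)
      (volume.restrict (parabolicCylinder L (0 : ℝ × EuclideanSpace ℝ (Fin 3)))) :=
    hU.1.distributional.1.aestronglyMeasurable
  have hprod : (volume.restrict (parabolicCylinder L (0 : ℝ × EuclideanSpace ℝ (Fin 3))) :
      Measure (ℝ × EuclideanSpace ℝ (Fin 3))) =
      (volume.restrict (Ioo (-L ^ 2) (0 : ℝ))).prod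
        (volume.restrict (ball (0 : EuclideanSpace ℝ (Fin 3)) L)) := by
    rw [SuitableCompactness.parabolicCylinder_zero, Measure.volume_eq_prod, Measure.prod_restrict]
  rw [hprod] at hm
  filter_upwards [hm.prodMk_left] with s hs
  exact hs

/-- `sup_{t>0} t³ μ{|f| > t} ≤ W` from the bound at every real height, any measure. [folklore] -/
private theorem eWeakLpPow_three_le_of_forall_real' {α : Type*} [MeasurableSpace α] {μ : Measure α}
    {E : Type*} [NormedAddCommGroup E] {f : α → E} {W : ℝ≥0∞}
    (h : ∀ σ : ℝ, 0 < σ → ENNReal.ofReal (σ ^ 3) * μ {x | σ < ‖f x‖} ≤ W) :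
    eWeakLpPow f 3 μ ≤ W := by
  unfold eWeakLpPow
  refine iSup_le fun t => ?_
  rcases eq_or_ne t 0 with rfl | ht
  · rw [ENNReal.coe_zero, ENNReal.toReal_ofNat, ENNReal.zero_rpow_of_pos (by norm_num), zero_mul]
    exact bot_le
  have htpos : (0 : ℝ) < t := lt_of_le_of_ne t.coe_nonneg fun h0 => ht (by exact_mod_cast h0.symm)
  have e1 : ((t : ℝ≥0∞)) ^ (3 : ℝ≥0∞).toReal = ENNReal.ofReal ((t : ℝ) ^ 3) := by
    rw [ENNReal.toReal_ofNat, show ((3 : ℝ)) = ((3 : ℕ) : ℝ) by norm_num, ENNReal.rpow_natCast,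
      ENNReal.ofReal_pow t.coe_nonneg, ENNReal.ofReal_coe_nnreal]
  have e2 : {x | (t : ℝ≥0∞) < ‖f x‖ₑ} = {x | (t : ℝ) < ‖f x‖} := by
    ext x
    simp only [mem_setOf_eq]
    rw [← ofReal_norm, ← ENNReal.ofReal_coe_nnreal, ENNReal.ofReal_lt_ofReal_iff_of_nonneg t.coe_nonneg]
  rw [e1, e2]
  exact h t htpos

/-- **Weak equicontinuity in time of the pairings, uniformly along the sequence** (Temam, Ch. III
§3; in print the role of (4.10)). Fix a test field `φ` with `tsupport φ ⊆ B(0,ρ₀)`, `ρ₀ > 0`, and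
levels `M ≥ 0`, `K`. There are `A, B ≥ 0` such that for EVERY suitable weak solution `(U, P)` in
`Q(0,L)`, `ρ₀ ≤ L`, with weak-`L³` slices `t³ |{y ∈ B(0,L) : t < |U(s,y)|}| ≤ M³` (`s ∈ ]-L²,0[`)
and `D(ρ₀; 0)[P] ≤ K`, the pairings satisfy `|∫⟪U(s),φ⟫ − ∫⟪U(s'),φ⟫| ≤ A|s−s'| + B|s−s'|^{1/3}`
for all `s, s'` in a full-measure subset of `]-ρ₀²,0[`.
[cite: Seregin2019, §4 (4.9)–(4.10) p. 8 (time regularity of the rescaled sequence)] -/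
theorem exists_uniform_pairing_modulus (M : ℝ) (K : ℝ≥0)
    {φ : EuclideanSpace ℝ (Fin 3) → EuclideanSpace ℝ (Fin 3)} (hφ : ContDiff ℝ (⊤ : ℕ∞) φ)
    (hφc : HasCompactSupport φ) {ρ₀ : ℝ} (hρ₀ : 0 < ρ₀)
    (hφρ : tsupport φ ⊆ ball (0 : EuclideanSpace ℝ (Fin 3)) ρ₀) :
    ∃ A B : ℝ, 0 ≤ A ∧ 0 ≤ B ∧
      ∀ (U : ℝ → EuclideanSpace ℝ (Fin 3) → EuclideanSpace ℝ (Fin 3))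
        (P : ℝ → EuclideanSpace ℝ (Fin 3) → ℝ) (L : ℝ), ρ₀ ≤ L →
        IsSuitableWeakSolutionInBall L (0 : ℝ × EuclideanSpace ℝ (Fin 3)) U P →
        (∀ s ∈ Ioo (-L ^ 2) (0 : ℝ), ∀ t : ℝ, 0 < t →
          ENNReal.ofReal (t ^ 3) *
            (volume.restrict (ball (0 : EuclideanSpace ℝ (Fin 3)) L)) {y | t < ‖U s y‖} ≤
            ENNReal.ofReal (M ^ 3)) →
        cknD ρ₀ (0 : ℝ × EuclideanSpace ℝ (Fin 3)) P ≤ K →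
        ∃ S : Set ℝ, (∀ᵐ s ∂(volume.restrict (Ioo (-ρ₀ ^ 2) 0)), s ∈ S) ∧ ∀ s ∈ S, ∀ s' ∈ S,
          |(∫ y, ⟪U s y, φ y⟫) - ∫ y, ⟪U s' y, φ y⟫| ≤ A * |s - s'| + B * |s - s'| ^ (1 / 3 : ℝ) := by
  set Ω : Opens (EuclideanSpace ℝ (Fin 3)) := ⟨ball 0 ρ₀, isOpen_ball⟩ with hΩdef
  have hΩset : ((Ω : Opens (EuclideanSpace ℝ (Fin 3))) : Set (EuclideanSpace ℝ (Fin 3))) = ball 0 ρ₀ := rfl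
  have hbΩ : Bornology.IsBounded ((Ω : Opens (EuclideanSpace ℝ (Fin 3))) :
      Set (EuclideanSpace ℝ (Fin 3))) := by rw [hΩset]; exact isBounded_ball
  have hηt : FunctionSpaces.IsTestFunctionOn Ω φ := ⟨hφ, hφc, hφρ⟩
  obtain ⟨K₀, K₁, K₂, hK₀, hK₁, hK₂⟩ := exists_bounds_of_isTestFunctionOn hηt
  -- ## the uniform constants
  set C : ℝ≥0∞ := volume (ball (0 : EuclideanSpace ℝ (Fin 3)) ρ₀) + 2 * ENNReal.ofReal (M ^ 3) with hC
  have hCtop : C ≠ ∞ := ENNReal.add_ne_top.2 ⟨measure_ball_lt_top.ne,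
    ENNReal.mul_ne_top (by norm_num) ENNReal.ofReal_ne_top⟩
  set Cp : ℝ≥0∞ := ENNReal.ofReal ρ₀ ^ 2 * K with hCp
  have hCptop : Cp ≠ ∞ := ENNReal.mul_ne_top (ENNReal.pow_ne_top ENNReal.ofReal_ne_top) ENNReal.coe_ne_top
  set A : ℝ := K₁ * C.toReal + K₂ * ((volume ((Ω : Opens (EuclideanSpace ℝ (Fin 3))) :
      Set (EuclideanSpace ℝ (Fin 3)))).toReal + C.toReal) with hAdef
  set B : ℝ := 3 * K₁ * (((volume ((Ω : Opens (EuclideanSpace ℝ (Fin 3))) :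
      Set (EuclideanSpace ℝ (Fin 3)))) ^ (1 / 2 : ℝ) * Cp) ^ (2 / 3 : ℝ)).toReal with hBdef
  have hK₁0 : 0 ≤ K₁ := (norm_nonneg _).trans (hK₁ 0)
  have hK₂0 : 0 ≤ K₂ := (norm_nonneg _).trans (hK₂ 0)
  refine ⟨A, B, by positivity, by positivity, fun U P L hL hU hslice hD => ?_⟩
  have hLpos : 0 < L := hρ₀.trans_le hL
  -- ## the pair on `]-ρ₀², 0[ × B(0, ρ₀)`
  set a : ℝ := (0 : ℝ × EuclideanSpace ℝ (Fin 3)).1 - ρ₀ ^ 2 with ha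
  set b : ℝ := (0 : ℝ × EuclideanSpace ℝ (Fin 3)).1 with hb
  have hab' : Ioo a b = Ioo (-ρ₀ ^ 2) 0 := by
    rw [ha, hb]; show Ioo ((0 : ℝ) - ρ₀ ^ 2) 0 = Ioo (-ρ₀ ^ 2) 0; rw [zero_sub]
  have hcyl : timeCylinder Ω a b = parabolicCylinderOpens ρ₀ (0 : ℝ × EuclideanSpace ℝ (Fin 3)) := rfl
  have hcyl_set : Ioo a b ×ˢ ((Ω : Opens (EuclideanSpace ℝ (Fin 3))) : Set (EuclideanSpace ℝ (Fin 3))) =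
      parabolicCylinder ρ₀ (0 : ℝ × EuclideanSpace ℝ (Fin 3)) := rfl
  have hsub : parabolicCylinder ρ₀ (0 : ℝ × EuclideanSpace ℝ (Fin 3)) ⊆
      parabolicCylinder L (0 : ℝ × EuclideanSpace ℝ (Fin 3)) := parabolicCylinder_mono hρ₀.le hL _
  have hsol : IsDistributionalNSSolutionOn (timeCylinder Ω a b) 1 0 U P := by
    rw [hcyl]
    exact hU.1.distributional.of_le fun z hz => hsub hz
  -- the sliced `L²` bound
  have hE : ∀ᵐ t ∂(volume.restrict (Ioo a b)),
      ∫⁻ x in ((Ω : Opens (EuclideanSpace ℝ (Fin 3))) : Set (EuclideanSpace ℝ (Fin 3))),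
        ‖U t x‖ₑ ^ 2 ≤ C := by
    rw [hab', hΩset]
    have hI : Ioo (-ρ₀ ^ 2) (0 : ℝ) ⊆ Ioo (-L ^ 2) 0 :=
      Ioo_subset_Ioo (by nlinarith [pow_le_pow_left₀ hρ₀.le hL 2]) le_rfl
    have hm := ae_restrict_of_ae_restrict_of_subset hI (ae_aestronglyMeasurable_slice_of_inBall hU)
    filter_upwards [hm, ae_restrict_mem measurableSet_Ioo] with s hs hsI
    have hW : eWeakLpPow (U s) 3 (volume.restrict (ball (0 : EuclideanSpace ℝ (Fin 3)) L)) ≤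
        ENNReal.ofReal (M ^ 3) :=
      eWeakLpPow_three_le_of_forall_real' fun σ hσ => hslice s (hI hsI) σ hσ
    have h1 := MemWeakLp.setLIntegral_enorm_sq_le_of_three hs (ball (0 : EuclideanSpace ℝ (Fin 3)) ρ₀)
    rw [Measure.restrict_restrict measurableSet_ball, inter_eq_left.2 (ball_subset_ball hL),
      Measure.restrict_apply' measurableSet_ball, inter_eq_left.2 (ball_subset_ball hL)] at h1
    refine h1.trans ?_
    rw [hC]
    gcongr
  -- the pressure bound
  have hP : ∫⁻ z in Ioo a b ×ˢ ((Ω : Opens (EuclideanSpace ℝ (Fin 3))) : Set (EuclideanSpace ℝ (Fin 3))),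
      ‖P z.1 z.2‖ₑ ^ (3 / 2 : ℝ) ≤ Cp := by
    rw [hcyl_set]
    have hρ2 : (ENNReal.ofReal ρ₀ ^ 2) ≠ 0 := pow_ne_zero _ (ENNReal.ofReal_pos.2 hρ₀).ne'
    have hρ2' : (ENNReal.ofReal ρ₀ ^ 2) ≠ ∞ := ENNReal.pow_ne_top ENNReal.ofReal_ne_top
    rw [cknD] at hD
    calc ∫⁻ z in parabolicCylinder ρ₀ (0 : ℝ × EuclideanSpace ℝ (Fin 3)), ‖P z.1 z.2‖ₑ ^ (3 / 2 : ℝ)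
        = ENNReal.ofReal ρ₀ ^ 2 * ((ENNReal.ofReal ρ₀ ^ 2)⁻¹ *
            ∫⁻ z in parabolicCylinder ρ₀ (0 : ℝ × EuclideanSpace ℝ (Fin 3)), ‖P z.1 z.2‖ₑ ^ (3 / 2 : ℝ)) := by
          rw [← mul_assoc, ENNReal.mul_inv_cancel hρ2 hρ2', one_mul]
      _ ≤ Cp := by rw [hCp]; gcongr
  -- ## the modulus
  obtain ⟨S, hS, hmod⟩ := NSCylinder.exists_fullMeasure_pairing_modulus hsol hbΩ hCtop hCptop hE hP
    hηt hK₁ hK₂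
  refine ⟨S, by rw [← hab']; exact hS, fun s hs s' hs' => ?_⟩
  have h1 := hmod s hs s' hs'
  rw [hΩset, ← integral_inner_eq_setIntegral_of_tsupport hφρ,
    ← integral_inner_eq_setIntegral_of_tsupport hφρ] at h1
  exact h1

/-- **The pairings near the top time are small** (Seregin 2019, §4 p. 8, the passage to
`u(x,0) = 0`, quantified along the sequence). With `A, B` from `exists_uniform_pairing_modulus`:
if in addition the top slice `U(0)` is the weak left limit of the slices in `L²(B(0,L))` and is
sparse, `|{y ∈ B(0,ϱ) : τ < |U(0,y)|}| ≤ m` with `tsupport φ ⊆ B(0,ϱ)`, `ϱ ≤ L`, then on the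
full-measure set `S` of the modulus, for every `λ > 0`,
`|∫⟪U(s),φ⟫| ≤ Θ₀ (m λ + ½ λ⁻² M³) + τ ∫|φ| + A|s| + B|s|^{1/3}` (`|φ| ≤ Θ₀`).
[cite: Seregin2019, §4 p. 8 (smallness of the rescaled top slices and u(x,0) = 0)] -/
theorem abs_top_pairing_le {M : ℝ} {L : ℝ} (hL : 0 < L)
    {U : ℝ → EuclideanSpace ℝ (Fin 3) → EuclideanSpace ℝ (Fin 3)} {P : ℝ → EuclideanSpace ℝ (Fin 3) → ℝ}
    (hU : IsSuitableWeakSolutionInBall L (0 : ℝ × EuclideanSpace ℝ (Fin 3)) U P)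
    (hslice : ∀ s ∈ Ioo (-L ^ 2) (0 : ℝ), ∀ t : ℝ, 0 < t →
      ENNReal.ofReal (t ^ 3) *
        (volume.restrict (ball (0 : EuclideanSpace ℝ (Fin 3)) L)) {y | t < ‖U s y‖} ≤
        ENNReal.ofReal (M ^ 3))
    (hcont : ∀ w : EuclideanSpace ℝ (Fin 3) → EuclideanSpace ℝ (Fin 3), MemLp w 2 volume →
      support w ⊆ ball (0 : EuclideanSpace ℝ (Fin 3)) L →
      Tendsto (fun s => ∫ y, ⟪U s y, w y⟫) (𝓝[<] 0) (𝓝 (∫ y, ⟪U 0 y, w y⟫)))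
    {ϱ τ m : ℝ} (hϱL : ϱ ≤ L) (hτ : 0 ≤ τ) (hm : 0 ≤ m)
    (hsparse : volume.restrict (ball (0 : EuclideanSpace ℝ (Fin 3)) ϱ) {y | τ < ‖U 0 y‖} ≤
      ENNReal.ofReal m)
    {φ : EuclideanSpace ℝ (Fin 3) → EuclideanSpace ℝ (Fin 3)} (hφ : ContDiff ℝ (⊤ : ℕ∞) φ)
    (hφc : HasCompactSupport φ) (hφϱ : tsupport φ ⊆ ball (0 : EuclideanSpace ℝ (Fin 3)) ϱ)
    {Θ₀ : ℝ} (hθb : ∀ y, ‖φ y‖ ≤ Θ₀)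
    {ρ₀ : ℝ} (hρ₀ : 0 < ρ₀) {A B : ℝ} {S : Set ℝ}
    (hS : ∀ᵐ s ∂(volume.restrict (Ioo (-ρ₀ ^ 2) 0)), s ∈ S)
    (hmod : ∀ s ∈ S, ∀ s' ∈ S,
      |(∫ y, ⟪U s y, φ y⟫) - ∫ y, ⟪U s' y, φ y⟫| ≤ A * |s - s'| + B * |s - s'| ^ (1 / 3 : ℝ))
    (hSI : S ⊆ Ioo (-ρ₀ ^ 2) 0)
    {lam : ℝ} (hlam : 0 < lam) :
    ∀ s ∈ S, |∫ y, ⟪U s y, φ y⟫| ≤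
      Θ₀ * (m * lam + 1 / 2 * lam⁻¹ ^ 2 * (ENNReal.ofReal (M ^ 3)).toReal) + τ * (∫ y, ‖φ y‖) +
        (A * |s| + B * |s| ^ (1 / 3 : ℝ)) := by
  intro s hs
  have hsI := hSI hs
  -- ## the top value is small (sparse slice)
  have hL2 : -L ^ 2 < (0 : ℝ) := by nlinarith
  have htop : |∫ y, ⟪U 0 y, φ y⟫| ≤
      Θ₀ * (m * lam + 1 / 2 * lam⁻¹ ^ 2 * (ENNReal.ofReal (M ^ 3)).toReal) + τ * ∫ y, ‖φ y‖ := by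
    refine abs_integral_inner_top_le (x₀ := (0 : EuclideanSpace ℝ (Fin 3))) (R := L) hL2
      (ae_aestronglyMeasurable_slice_of_inBall hU) ENNReal.ofReal_ne_top
      (fun t ht => eWeakLpPow_three_le_of_forall_real' fun σ hσ => hslice t ht σ hσ)
      hcont (ball_subset_ball hϱL) hτ hm hsparse (hφ.continuous.aestronglyMeasurable) hθb
      ((subset_tsupport φ).trans hφϱ) hlam
  -- ## from `s` to the top along good times `s'ₙ ↑ 0`
  have hgood : ∀ᵐ s' ∂(volume : Measure ℝ), s' ∈ Ioo (-ρ₀ ^ 2) 0 → s' ∈ S :=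
    (ae_restrict_iff' measurableSet_Ioo).1 hS
  have hseq : ∃ sn : ℕ → ℝ, ∀ n, sn n ∈ S ∧ -(1 / ((n : ℝ) + 1)) < sn n ∧ sn n < 0 := by
    have h : ∀ n : ℕ, ∃ s', s' ∈ S ∧ -(1 / ((n : ℝ) + 1)) < s' ∧ s' < 0 := by
      intro n
      have hpos : (0 : ℝ) < 1 / ((n : ℝ) + 1) := by positivity
      have hlt : max (-ρ₀ ^ 2) (-(1 / ((n : ℝ) + 1))) < 0 :=
        max_lt (by nlinarith) (by linarith)
      obtain ⟨s', hs'I, hP⟩ := exists_mem_Ioo_of_ae hgood hlt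
      exact ⟨s', hP ⟨(le_max_left _ _).trans_lt hs'I.1, hs'I.2⟩, (le_max_right _ _).trans_lt hs'I.1, hs'I.2⟩
    choose sn hsn using h
    exact ⟨sn, hsn⟩
  obtain ⟨sn, hsn⟩ := hseq
  have hsn_lim : Tendsto sn atTop (𝓝[<] 0) := by
    refine tendsto_nhdsWithin_iff.2 ⟨?_, Eventually.of_forall fun n => (hsn n).2.2⟩
    have h1 : Tendsto (fun n : ℕ => -(1 / ((n : ℝ) + 1))) atTop (𝓝 0) := by
      have h : Tendsto (fun n : ℕ => 1 / ((n : ℝ) + 1)) atTop (𝓝 0) :=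
        tendsto_one_div_add_atTop_nhds_zero_nat
      have h2 := h.neg
      rwa [neg_zero] at h2
    exact tendsto_of_tendsto_of_tendsto_of_le_of_le h1 tendsto_const_nhds
      (fun n => (hsn n).2.1.le) (fun n => (hsn n).2.2.le)
  have hφ2 : MemLp φ 2 volume := hφ.continuous.memLp_of_hasCompactSupport hφc
  have hφs : support φ ⊆ ball (0 : EuclideanSpace ℝ (Fin 3)) L :=
    ((subset_tsupport φ).trans hφϱ).trans (ball_subset_ball hϱL)
  have hconv : Tendsto (fun n => ∫ y, ⟪U (sn n) y, φ y⟫) atTop (𝓝 (∫ y, ⟪U 0 y, φ y⟫)) :=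
    (hcont φ hφ2 hφs).comp hsn_lim
  -- `|P(s) - P(sₙ)| ≤ A|s - sₙ| + B|s - sₙ|^{1/3} → A|s| + B|s|^{1/3}`
  have hdiff : Tendsto (fun n => A * |s - sn n| + B * |s - sn n| ^ (1 / 3 : ℝ)) atTop
      (𝓝 (A * |s| + B * |s| ^ (1 / 3 : ℝ))) := by
    have h0 : Tendsto sn atTop (𝓝 0) := tendsto_nhdsWithin_iff.1 hsn_lim |>.1
    have h1 : Tendsto (fun n => |s - sn n|) atTop (𝓝 |s|) := by
      have := (tendsto_const_nhds (x := s)).sub h0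
      rw [sub_zero] at this
      exact this.abs
    have h2 : Tendsto (fun n => |s - sn n| ^ (1 / 3 : ℝ)) atTop (𝓝 (|s| ^ (1 / 3 : ℝ))) :=
      h1.rpow_const (Or.inr (by norm_num))
    exact (h1.const_mul A).add (h2.const_mul B)
  have hPs : Tendsto (fun n => (∫ y, ⟪U s y, φ y⟫) - ∫ y, ⟪U (sn n) y, φ y⟫) atTop
      (𝓝 ((∫ y, ⟪U s y, φ y⟫) - ∫ y, ⟪U 0 y, φ y⟫)) := tendsto_const_nhds.sub hconv
  have hle : |(∫ y, ⟪U s y, φ y⟫) - ∫ y, ⟪U 0 y, φ y⟫| ≤ A * |s| + B * |s| ^ (1 / 3 : ℝ) :=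
    le_of_tendsto_of_tendsto' hPs.abs hdiff fun n => hmod s hs (sn n) (hsn n).1
  -- ## conclusion
  calc |∫ y, ⟪U s y, φ y⟫|
      = |((∫ y, ⟪U s y, φ y⟫) - ∫ y, ⟪U 0 y, φ y⟫) + ∫ y, ⟪U 0 y, φ y⟫| := by rw [sub_add_cancel]
    _ ≤ |(∫ y, ⟪U s y, φ y⟫) - ∫ y, ⟪U 0 y, φ y⟫| + |∫ y, ⟪U 0 y, φ y⟫| := abs_add_le _ _
    _ ≤ (A * |s| + B * |s| ^ (1 / 3 : ℝ)) +
        (Θ₀ * (m * lam + 1 / 2 * lam⁻¹ ^ 2 * (ENNReal.ofReal (M ^ 3)).toReal) + τ * ∫ y, ‖φ y‖) :=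
        add_le_add hle htop
    _ = _ := by ring

end Seregin2019

end Literature.Analysis.FluidPDE

end
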